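import Summits.ResolutionOfSingularities.ResolutionOfSingularities.Theorems.PurelyInseparableDim4ResConeCInfSecondTschirnhausSharpPrime
import Summits.ResolutionOfSingularities.ResolutionOfSingularities.Theorems.PurelyInseparableDim4ResConeCInfVirtualEntryRotationPrime
import HarnessLib
import HarnessLib.Audit.Tags

/-!
# Purely inseparable four-folds — THE ♯-VIRTUAL ENTRY FOR EVERY PRIME (ENTRY♯ pieces E3♯ + E4♯ of res-dim4-p-3 g6's FLAGLESS♯ plan): from a
# FRAMED regime-R LAYER state `C₁` with the row's ♯-flag, a virtual state `B = clean (tsch u ψ C₁)` carrying the 13-conjunct ♯-FRAME of the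
# ♯-window, and the composition with an incoming slot-unit relation (cell `res-dim4-pi`, K2(p) lane, rung-1 POWER-CONE LINE «light pair of
# TAIL(p, p−1, 3) ∀ p», flagless branch; seat res-dim4-typ-1 g6)

[OURS · counted 0 · cell `res-dim4-pi` · K2(p) lane (holder res-dim4-p-12 g5, ruling 14:57Z «(γ) first»); res-dim4-p-3 g6's by-signature list (bus
2026-08-29 14:53Z / 14:55Z): «E3♯ = ENTRY-3 `exists_cInf_virtual_entry_of_framed_prime` (p717011) with W8 ↦ ♯6-row and the frame tuple extended;
E4♯ = ENTRY-4 §1 `exists_cInf_virtual_entry_of_rel_prime` (p717381) verbatim with E3♯ inside».]  Nothing here proves K2(p) for any `p`, any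
TAIL(p, p−1, 3), FLAGLESS♯, `NoIsolatedTrap p p`, the Cossart–Jannsen–Saito theorem or resolution of singularities in dimension ≥ 4 /
characteristic `p` — NOT proved.  AI kernel work, weaker than expert review.  ENTRY bookkeeping about OUR frame: kills nothing by itself; it ASSUMES
the row's ♯-flag, regime R and LAYER at `C₁` (E5♯, res-dim4-p-3's side, supplies them on a chain).

* §1 **`exists_cInf_virtual_entry_of_framed_sharp_prime`** (E3♯; `d + 1 = p`, row `c`, `c + 3 ≤ d`; letters `λ, μ, u, f`).  INPUT BY VALUE: a
  state `C₁` and an `f`-datum `Φ` with `C₁.F = clean (tsch f Φ G)`, order `d + 2`, `r = x_λx_μ ∣ F`, `resForm C₁ = a·x_f^d`, exact ledger,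
  REGIME R («`e_f + 2 ≤ d ⇒ e_λ, e_μ ≥ 3`»), LAYER («no monomial of degree `d + 3` with `e_f + 2 ≤ d`»), isolated, `e_G = 3`, and the row's
  ♯-FLAG `coeff_{r + 2λ+2μ+(d−2−c)u+c·f} C₁.F ≠ 0`.  OUTPUT for every jet `N`: `B, θ` (slot-unit shape, unipotent free block, no constants) with
  `B.F = clean (aeval θ G)` and the ♯-FRAME of `B` at jet `N`: order, `r`, `x^r ∣`, `resForm = a·x_f^d` and its support dress, exact ledger,
  regime R, LAYER, the dead ROW `(u, f) = (d − 3 − c, c)` below `N`, the row's ♯-flag `coeff_{x_λ³x_μ³x_u^{d−2−c}x_f^c} ≠ 0`, isolated,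
  `e_G = 3`.  ROUTE = ENTRY-3 verbatim with ♯6-row `exists_second_tschirnhaus_sharp_row_prime` (ledger♯ read-off from regime R, LAYER entry from
  LAYER), regime R transported by `lowLedger_tsch_of_ne` (thresholds `3, 3`, bound `d − 1`), LAYER by ♯6 `tsch_layer_prime` and `coeff_deletePthPowers`.
* §2 **`exists_cInf_virtual_entry_of_rel_sharp_prime`** (E4♯) — E3♯ composed with an incoming ℛ²-relation `(π₀, A, A₁)` at precision `M`:
  `B₀` related to `A` along `π₀` at precision `M` with the ♯-frame — the `hE♯` conjuncts of `SwapTransport.cInf_no_chain_of_entry_sharp_prime`.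
[cite: CossartJannsenSaito2020, Thm. 3.14, Lemma 13.2] [cite: Hauser2010, §§F–G] [cite: Abhyankar1990, Lecture 26 pp. 228–229]
bears_on: LADDER-RESOLUTION:D157-DOOR2 (res-dim4-pi · K2(p) · power cones · flagless branch ENTRY♯ E3♯/E4♯).  Supports
stmt-ResolutionOfSingularities-16155 (helper).
-/

set_option linter.dupNamespace false -- mandated namespace of this single-conjunct summit

noncomputable section

namespace Summit.ResolutionOfSingularities.ResolutionOfSingularities.Theorems.PIDim4

namespace ResCone

open MvPolynomial Finset FrameChange
open Literature.AlgebraicGeometry.Resolution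
open Literature.AlgebraicGeometry.Resolution.CentreBlowup
open Literature.AlgebraicGeometry.Resolution.Hauser2010
open Literature.AlgebraicGeometry.Resolution.HauserPerlega2019
open PointBlowup (translate)

variable {K : Type} [Field K]

/-! ## §1 The ♯-entry from a framed regime-R LAYER state -/

/-- **THE ♯-VIRTUAL ENTRY, every prime, given the row's ♯-flag** (E3♯; statement and route in the module docstring). [OURS]
[cite: CossartJannsenSaito2020, Thm. 3.14, Lemma 13.2] -/
theorem exists_cInf_virtual_entry_of_framed_sharp_prime [DecidableEq K] (p : ℕ) [hp : Fact p.Prime] [CharP K p] {d c : ℕ}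
    (hdp : d + 1 = p) (hc : c + 3 ≤ d) {la mu u f : Fin 4} (hlm : la ≠ mu) (hlu : la ≠ u)
    (hlf : la ≠ f) (hmu : mu ≠ u) (hmf : mu ≠ f) (huf : u ≠ f) {C₁ : State K} {G Φ : MvPolynomial (Fin 4) K}
    (hΦvars : f ∉ Φ.vars) (hΦ0 : constantCoeff Φ = 0) (hC₁F : C₁.F = deletePthPowers p (tsch f Φ G))
    (hoC₁ : ordZero C₁.F = ((d + 2 : ℕ) : ℕ∞)) (hrC₁ : C₁.r = Finsupp.single la 1 + Finsupp.single mu 1)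
    (hdivC₁ : ∀ e ∈ C₁.F.support, C₁.r ≤ e) {a : K} (ha : a ≠ 0) (hresC₁ : resForm C₁ = C a * X f ^ d)
    (hledC₁ : ∀ e ∈ C₁.F.support, e f ≤ d - 1 → 2 ≤ e la ∧ 2 ≤ e mu)
    (hRC₁ : ∀ e ∈ C₁.F.support, e f + 2 ≤ d → 3 ≤ e la ∧ 3 ≤ e mu)
    (hlayerC₁ : ∀ E : Fin 4 →₀ ℕ, E.degree = d + 3 → E f + 2 ≤ d → coeff E C₁.F = 0)
    (hisoC₁ : IsIsolated p C₁.F) (he3C₁ : Module.finrank K (resVertex C₁) = 3)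
    (hg : coeff (C₁.r + (Finsupp.single la 2 + Finsupp.single mu 2 + Finsupp.single u (d - 2 - c) + Finsupp.single f c)) C₁.F ≠ 0)
    (N : ℕ) :
    ∃ (B : State K) (θ : Fin 4 → MvPolynomial (Fin 4) K),
      θ la = X la ∧ θ mu = X mu ∧ constantCoeff (θ u) = 0 ∧ constantCoeff (θ f) = 0 ∧
      coeff (Finsupp.single u 1) (θ u) * coeff (Finsupp.single f 1) (θ f) -
        coeff (Finsupp.single f 1) (θ u) * coeff (Finsupp.single u 1) (θ f) ≠ 0 ∧
      B.F = deletePthPowers p (aeval θ G) ∧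
      (ordZero B.F = ((d + 2 : ℕ) : ℕ∞) ∧ B.r = Finsupp.single la 1 + Finsupp.single mu 1 ∧
        (∀ e ∈ B.F.support, B.r ≤ e) ∧ (∃ a : K, a ≠ 0 ∧ resForm B = C a * X f ^ d) ∧
        (∀ e ∈ B.F.support, e.degree = d + 2 → e = Finsupp.single la 1 + Finsupp.single mu 1 + Finsupp.single u 0 + Finsupp.single f d) ∧
        (∀ e ∈ B.F.support, e f ≤ d - 1 → 2 ≤ e la ∧ 2 ≤ e mu) ∧
        (∀ e ∈ B.F.support, e f + 2 ≤ d → 3 ≤ e la) ∧ (∀ e ∈ B.F.support, e f + 2 ≤ d → 3 ≤ e mu) ∧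
        (∀ E : Fin 4 →₀ ℕ, E.degree = d + 3 → E f + 2 ≤ d → coeff E B.F = 0) ∧
        (∀ e ∈ B.F.support, e.degree < N → ¬ (e u = d - 3 - c ∧ e f = c)) ∧
        coeff (Finsupp.single la 3 + Finsupp.single mu 3 + Finsupp.single u (d - 2 - c) + Finsupp.single f c) B.F ≠ 0 ∧
        IsIsolated p B.F ∧ Module.finrank K (resVertex B) = 3) := by
  have hd2 : 2 ≤ d := by omega
  have hpd : ¬ p ∣ d + 2 := not_dvd_add_two_of_succ_eq hp.out hdp
  have hdK : ((d - c - 2 : ℕ) : K) ≠ 0 := natCast_ne_zero_of_pos_of_lt_prime p (by omega) (by omega)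
  have hrdegC₁ : C₁.r.degree = 2 := by rw [hrC₁, map_add, Finsupp.degree_single, Finsupp.degree_single]
  have hrfC₁ : C₁.r f = 0 := by
    rw [hrC₁, Finsupp.add_apply, Finsupp.single_eq_of_ne hlf.symm, Finsupp.single_eq_of_ne hmf.symm, add_zero]
  have hruC₁ : C₁.r u = 0 := by
    rw [hrC₁, Finsupp.add_apply, Finsupp.single_eq_of_ne hlu.symm, Finsupp.single_eq_of_ne hmu.symm, add_zero]
  have hrlC₁ : C₁.r la = 1 := by
    rw [hrC₁, Finsupp.add_apply, Finsupp.single_eq_same, Finsupp.single_eq_of_ne hlm, add_zero]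
  have hrmC₁ : C₁.r mu = 1 := by
    rw [hrC₁, Finsupp.add_apply, Finsupp.single_eq_of_ne hlm.symm, Finsupp.single_eq_same, zero_add]
  have hstrC₁ := straight_readings_of_resForm_prime hoC₁ hrdegC₁ hresC₁
  have hC₁clean : deletePthPowers p C₁.F = C₁.F := by rw [hC₁F]; exact PointBlowup.deletePthPowers_deletePthPowers p _
  -- the support dress of straightness at `C₁`, for the LAYER transport
  have hlowC₁ : ∀ β ∈ C₁.F.support, β.degree ≤ d + 2 → d - 1 ≤ β f := by
    intro β hβ hdeg
    have h6 := le_degree_of_mem_support_of_ordZero hoC₁ hβ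
    obtain ⟨m, rfl⟩ : ∃ m, β = C₁.r + m := ⟨β - C₁.r, (add_tsub_cancel_of_le (hdivC₁ β hβ)).symm⟩
    have hm : m.degree = d := by rw [map_add, hrdegC₁] at hdeg h6; omega
    by_cases hmf : m = Finsupp.single f d
    · rw [hmf, Finsupp.add_apply, hrfC₁, Finsupp.single_eq_same]; omega
    · exact absurd (hstrC₁.2 m hm hmf) (mem_support_iff.mp hβ)
  -- the ♯-shift of the flag monomial
  have hshift : (Finsupp.single la 3 + Finsupp.single mu 3 + Finsupp.single u (d - 2 - c) + Finsupp.single f c : Fin 4 →₀ ℕ) =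
      C₁.r + (Finsupp.single la 2 + Finsupp.single mu 2 + Finsupp.single u (d - 2 - c) + Finsupp.single f c) := by
    rw [hrC₁, show (Finsupp.single la 3 : Fin 4 →₀ ℕ) = Finsupp.single la 1 + Finsupp.single la 2 by rw [← Finsupp.single_add],
      show (Finsupp.single mu 3 : Fin 4 →₀ ℕ) = Finsupp.single mu 1 + Finsupp.single mu 2 by rw [← Finsupp.single_add]]
    abel
  -- (5♯) the ♯-Tschirnhaus at `C₁` on the row `c` (♯6-row)
  obtain ⟨ψ, hψ0, hψu, hψf, hψsupp, hrowψ, hgψ, -⟩ := exists_second_tschirnhaus_sharp_row_prime (K := K) hlm hlu.symm hmu.symm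
    hlf.symm hmf.symm huf.symm (G := C₁.F.divMonomial C₁.r) (M := N + d + 2) (d := d) (c := c) hc hdK (by omega)
    (fun n hnf hnM hn => by
      rw [coeff_divMonomial]
      by_contra hne
      have hmem := mem_support_iff.mpr hne
      have h := hRC₁ _ hmem (by rw [Finsupp.add_apply, hrfC₁, zero_add, hnf]; omega)
      rw [Finsupp.add_apply, Finsupp.add_apply, hrlC₁, hrmC₁] at h
      omega)
    (by rw [coeff_divMonomial]; exact hg)
    (by
      rw [coeff_divMonomial]
      refine hlayerC₁ _ (by simp only [map_add, hrdegC₁, Finsupp.degree_single]; omega) ?_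
      rw [Finsupp.add_apply, hrfC₁, zero_add, (quad_apply hlm hlu hlf hmu hmf huf 2 2 (d - 3 - c) c).2.2.2]
      omega)
    N
  -- (6) the virtual state and the substitution
  have hG : C₁.F = monomial C₁.r 1 * C₁.F.divMonomial C₁.r := (monomial_mul_divMonomial hdivC₁).symm
  have hoB : ordZero (deletePthPowers p (tsch u ψ C₁.F)) = ((d + 2 : ℕ) : ℕ∞) := by
    rw [ordZero_clean_tsch p hψu hψ0 hC₁clean]; exact hoC₁
  have hdivB : ∀ e ∈ (deletePthPowers p (tsch u ψ C₁.F)).support, C₁.r ≤ e := forall_le_of_mem_support_clean_tsch p hruC₁ hdivC₁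
  have hresB : resForm (⟨deletePthPowers p (tsch u ψ C₁.F), C₁.r, C₁.exc⟩ : State K) = C a * X f ^ d := by
    rw [resForm_cleanTschState_eq p hψu hψ0 hoC₁ hpd, resForm_tschState_eq_tsch_linearPart hψu hψ0 hruC₁ hdivC₁, hresC₁,
      map_mul, FrameChange.tsch_C, map_pow, tsch_X_of_ne _ huf.symm]
  refine ⟨⟨deletePthPowers p (tsch u ψ C₁.F), C₁.r, C₁.exc⟩, fun i => tsch u ψ (tsch f Φ (X i)),
    ?_, ?_, ?_, ?_, ?_, ?_, hoB, hrC₁, hdivB, ⟨_, ha, hresB⟩, ?_, ?_, ?_, ?_, ?_, ?_, ?_, ?_, ?_⟩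
  · dsimp only
    rw [tsch_X_of_ne _ hlf, tsch_X_of_ne _ hlu]
  · dsimp only
    rw [tsch_X_of_ne _ hmf, tsch_X_of_ne _ hmu]
  · dsimp only
    rw [tsch_X_of_ne _ huf, tsch_X_self, map_add, constantCoeff_X, zero_add, hψ0]
  · dsimp only
    rw [tsch_X_self, map_add, tsch_X_of_ne _ huf.symm, map_add, constantCoeff_X, zero_add, constantCoeff_tsch hψ0, hΦ0]
  · -- the free tangent block is unipotent
    have hψu1 : coeff (Finsupp.single u 1) ψ = 0 := by
      by_contra h
      have := (hψsupp _ (mem_support_iff.mpr h)).1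
      rw [Finsupp.single_eq_same] at this
      exact one_ne_zero this
    have hψf1 : coeff (Finsupp.single f 1) ψ = 0 := by
      by_contra h
      have := (hψsupp _ (mem_support_iff.mpr h)).2.1
      rw [Finsupp.single_eq_same] at this
      exact one_ne_zero this
    have hΦf1 : coeff (Finsupp.single f 1) (tsch u ψ Φ) = 0 := by
      by_contra h
      obtain ⟨b, hb, hbf, -⟩ := exists_of_mem_support_tsch huf hψ0 hψf Φ (mem_support_iff.mpr h)
      rw [Finsupp.single_eq_same] at hbf
      have := (FrameChange.not_mem_vars_iff f Φ).mp hΦvars b hb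
      omega
    have hfu : coeff (Finsupp.single f 1) (X u : MvPolynomial (Fin 4) K) = 0 := by
      rw [coeff_X, if_neg]
      intro h
      have := DFunLike.congr_fun h f
      rw [Finsupp.single_eq_same, Finsupp.single_eq_of_ne huf.symm] at this
      omega
    have huf' : coeff (Finsupp.single u 1) (X f : MvPolynomial (Fin 4) K) = 0 := by
      rw [coeff_X, if_neg]
      intro h
      have := DFunLike.congr_fun h u
      rw [Finsupp.single_eq_same, Finsupp.single_eq_of_ne huf] at this
      omega
    dsimp only
    rw [tsch_X_of_ne _ huf, tsch_X_self, tsch_X_self, map_add, tsch_X_of_ne _ huf.symm, coeff_add, coeff_add, coeff_add,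
      coeff_add, coeff_X_same, coeff_X_same, hfu, huf', hψu1, hψf1, hΦf1]
    norm_num
  · -- the relation: cleaning commutes with the substitutions
    show deletePthPowers p (tsch u ψ C₁.F) = deletePthPowers p (aeval (fun i => tsch u ψ (tsch f Φ (X i))) G)
    have hcomp : (aeval (fun i => tsch u ψ (tsch f Φ (X i))) : MvPolynomial (Fin 4) K →ₐ[K] MvPolynomial (Fin 4) K) =
        (tsch u ψ).comp (tsch f Φ) := MvPolynomial.algHom_ext fun i => by rw [aeval_X, AlgHom.comp_apply]
    rw [hcomp, AlgHom.comp_apply, hC₁F, FrameChange.tsch, FrameChange.tsch,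
      SwapTransport.deletePthPowers_aeval_deletePthPowers p]
  · -- the support dress of straightness
    intro e he hdeg
    have hrdegB : (⟨deletePthPowers p (tsch u ψ C₁.F), C₁.r, C₁.exc⟩ : State K).r.degree = 2 := hrdegC₁
    obtain ⟨-, hst⟩ := straight_readings_of_resForm_prime hoB hrdegB hresB
    obtain ⟨m, rfl⟩ : ∃ m, e = C₁.r + m := ⟨e - C₁.r, (add_tsub_cancel_of_le (hdivB e he)).symm⟩
    have hm : m.degree = d := by rw [map_add, hrdegC₁] at hdeg; omega
    by_cases hmf : m = Finsupp.single f d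
    · rw [hmf, hrC₁, Finsupp.single_zero, add_zero]
    · exact absurd (hst m hm hmf) (mem_support_iff.mp he)
  · intro e he hef'
    exact lowLedger_deletePthPowers p (lowLedger_tsch_of_ne hlu.symm hmu.symm huf ψ (d := d) (ra := 2) (ra' := 2)
      (fun e he hef' => hledC₁ e he (by omega))) e he (by omega)
  · intro e he hef'
    exact (lowLedger_deletePthPowers p (lowLedger_tsch_of_ne hlu.symm hmu.symm huf ψ (d := d - 1) (ra := 3) (ra' := 3)
      (fun e he hef' => hRC₁ e he (by omega))) e he (by omega)).1
  · intro e he hef'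
    exact (lowLedger_deletePthPowers p (lowLedger_tsch_of_ne hlu.symm hmu.symm huf ψ (d := d - 1) (ra := 3) (ra' := 3)
      (fun e he hef' => hRC₁ e he (by omega))) e he (by omega)).2
  · -- LAYER through the move and the cleaning
    intro E hE hEf
    show coeff E (deletePthPowers p (tsch u ψ C₁.F)) = 0
    rw [coeff_deletePthPowers]
    split_ifs
    · rfl
    · exact tsch_layer_prime huf hψ0 hψf hlowC₁ hlayerC₁ E hE hEf
  · intro e he heN
    rw [hG, tsch_monomial_mul ψ hruC₁] at he
    have he' := mem_support_of_mem_support_deletePthPowers p he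
    exact row_support_of_coeff hruC₁ hrfC₁ (B := N) (eu := d - 3 - c) (ef := c)
      (fun m h1 h2 h3 => hrowψ m h1 h2 (by omega) (by omega)) he' (by rw [hrdegC₁]; omega)
  · show coeff _ (deletePthPowers p (tsch u ψ C₁.F)) ≠ 0
    rw [hshift, hG, tsch_monomial_mul ψ hruC₁, coeff_deletePthPowers, if_neg, coeff_monomial_mul', if_pos le_self_add,
      add_tsub_cancel_left, one_mul, hgψ, coeff_divMonomial]
    · exact hg
    · refine not_isPthPowerExponent_of_not_dvd (i := u) ?_
      rw [Finsupp.add_apply, hruC₁, zero_add, (quad_apply hlm hlu hlf hmu hmf huf 2 2 (d - 2 - c) c).2.2.1]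
      exact Nat.not_dvd_of_pos_of_lt (by omega) (by omega)
  · exact (isIsolated_clean_tsch_iff p hψu hψ0 _).mpr hisoC₁
  · exact (finrank_resVertex_cleanTschState p hψu hψ0 hruC₁ hdivC₁ hoC₁ hpd).trans he3C₁

/-! ## §2 Composition of the ♯-entry with an incoming relation -/

/-- **THE ♯-VIRTUAL ENTRY ALONG A RELATION, every prime** (E4♯; module docstring §2). [OURS]
[cite: CossartJannsenSaito2020, Thm. 3.14, Lemma 13.2] -/
theorem exists_cInf_virtual_entry_of_rel_sharp_prime [DecidableEq K] (p : ℕ) [hp : Fact p.Prime] [CharP K p] {d c : ℕ}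
    (hdp : d + 1 = p) (hc : c + 3 ≤ d) {la mu u f : Fin 4} (hlm : la ≠ mu) (hlu : la ≠ u) (hlf : la ≠ f) (hmu : mu ≠ u)
    (hmf : mu ≠ f) (huf : u ≠ f) {π₀ : Equiv.Perm (Fin 4)} {A A₁ C₁ : State K} {θ' e' : Fin 4 → MvPolynomial (Fin 4) K}
    {U' E' : MvPolynomial (Fin 4) K} {M : ℕ}
    (hθ'la : θ' (π₀ la) = X la * e' la) (hθ'mu : θ' (π₀ mu) = X mu * e' mu) (he'la : constantCoeff (e' la) ≠ 0)
    (he'mu : constantCoeff (e' mu) ≠ 0) (hu0' : constantCoeff (θ' (π₀ u)) = 0) (hf0' : constantCoeff (θ' (π₀ f)) = 0)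
    (hdet' : coeff (Finsupp.single u 1) (θ' (π₀ u)) * coeff (Finsupp.single f 1) (θ' (π₀ f)) -
      coeff (Finsupp.single f 1) (θ' (π₀ u)) * coeff (Finsupp.single u 1) (θ' (π₀ f)) ≠ 0)
    (hU' : constantCoeff U' ≠ 0) (hE' : E' ∈ originIdeal K ^ M)
    (hrel' : A₁.F = deletePthPowers p (U' ^ p * aeval θ' A.F) + E')
    {Φ : MvPolynomial (Fin 4) K} (hΦvars : f ∉ Φ.vars) (hΦ0 : constantCoeff Φ = 0)
    (hC₁F : C₁.F = deletePthPowers p (tsch f Φ A₁.F)) (hoC₁ : ordZero C₁.F = ((d + 2 : ℕ) : ℕ∞))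
    (hrC₁ : C₁.r = Finsupp.single la 1 + Finsupp.single mu 1) (hdivC₁ : ∀ e ∈ C₁.F.support, C₁.r ≤ e) {a : K}
    (ha : a ≠ 0) (hresC₁ : resForm C₁ = C a * X f ^ d)
    (hledC₁ : ∀ e ∈ C₁.F.support, e f ≤ d - 1 → 2 ≤ e la ∧ 2 ≤ e mu)
    (hRC₁ : ∀ e ∈ C₁.F.support, e f + 2 ≤ d → 3 ≤ e la ∧ 3 ≤ e mu)
    (hlayerC₁ : ∀ E : Fin 4 →₀ ℕ, E.degree = d + 3 → E f + 2 ≤ d → coeff E C₁.F = 0)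
    (hisoC₁ : IsIsolated p C₁.F) (he3C₁ : Module.finrank K (resVertex C₁) = 3)
    (hg : coeff (C₁.r + (Finsupp.single la 2 + Finsupp.single mu 2 + Finsupp.single u (d - 2 - c) + Finsupp.single f c)) C₁.F ≠ 0)
    (N : ℕ) :
    ∃ B₀ : State K,
      (∃ (θ e : Fin 4 → MvPolynomial (Fin 4) K) (U E : MvPolynomial (Fin 4) K),
        θ (π₀ la) = X la * e la ∧ θ (π₀ mu) = X mu * e mu ∧ constantCoeff (e la) ≠ 0 ∧ constantCoeff (e mu) ≠ 0 ∧
        constantCoeff (θ (π₀ u)) = 0 ∧ constantCoeff (θ (π₀ f)) = 0 ∧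
        coeff (Finsupp.single u 1) (θ (π₀ u)) * coeff (Finsupp.single f 1) (θ (π₀ f)) -
          coeff (Finsupp.single f 1) (θ (π₀ u)) * coeff (Finsupp.single u 1) (θ (π₀ f)) ≠ 0 ∧
        constantCoeff U ≠ 0 ∧ E ∈ originIdeal K ^ M ∧ B₀.F = deletePthPowers p (U ^ p * aeval θ A.F) + E) ∧
      (ordZero B₀.F = ((d + 2 : ℕ) : ℕ∞) ∧ B₀.r = Finsupp.single la 1 + Finsupp.single mu 1 ∧
        (∀ e ∈ B₀.F.support, B₀.r ≤ e) ∧ (∃ a : K, a ≠ 0 ∧ resForm B₀ = C a * X f ^ d) ∧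
        (∀ e ∈ B₀.F.support, e.degree = d + 2 → e = Finsupp.single la 1 + Finsupp.single mu 1 + Finsupp.single u 0 + Finsupp.single f d) ∧
        (∀ e ∈ B₀.F.support, e f ≤ d - 1 → 2 ≤ e la ∧ 2 ≤ e mu) ∧
        (∀ e ∈ B₀.F.support, e f + 2 ≤ d → 3 ≤ e la) ∧ (∀ e ∈ B₀.F.support, e f + 2 ≤ d → 3 ≤ e mu) ∧
        (∀ E : Fin 4 →₀ ℕ, E.degree = d + 3 → E f + 2 ≤ d → coeff E B₀.F = 0) ∧
        (∀ e ∈ B₀.F.support, e.degree < N → ¬ (e u = d - 3 - c ∧ e f = c)) ∧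
        coeff (Finsupp.single la 3 + Finsupp.single mu 3 + Finsupp.single u (d - 2 - c) + Finsupp.single f c) B₀.F ≠ 0 ∧
        IsIsolated p B₀.F ∧ Module.finrank K (resVertex B₀) = 3) := by
  have hex : ∀ i : Fin 4, i = la ∨ i = mu ∨ i = u ∨ i = f := letters_exhaust hlm hlu hlf hmu hmf huf
  obtain ⟨B, θ₂, h1, h2, h3, h4, h5, h6, hfr⟩ :=
    exists_cInf_virtual_entry_of_framed_sharp_prime p hdp hc hlm hlu hlf hmu hmf huf hΦvars hΦ0 hC₁F hoC₁ hrC₁ hdivC₁ ha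
      hresC₁ hledC₁ hRC₁ hlayerC₁ hisoC₁ he3C₁ hg N
  -- composition of the two relations
  have hθ₂0 : ∀ i, constantCoeff (θ₂ i) = 0 := fun i => by
    rcases hex i with rfl | rfl | rfl | rfl
    · rw [h1]; exact constantCoeff_X (R := K) _
    · rw [h2]; exact constantCoeff_X (R := K) _
    · exact h3
    · exact h4
  have hrelB : B.F = deletePthPowers p ((aeval θ₂ U') ^ p * aeval (fun i => aeval θ₂ (θ' i)) A.F) +
      deletePthPowers p (aeval θ₂ E') := by
    rw [h6, hrel', map_add, deletePthPowers_add, SwapTransport.deletePthPowers_aeval_deletePthPowers p, map_mul, map_pow,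
      ApproxCoordChange.aeval_aeval]
  have hsla : aeval θ₂ (θ' (π₀ la)) = X la * aeval θ₂ (e' la) := by rw [hθ'la, map_mul, aeval_X, h1]
  have hsmu : aeval θ₂ (θ' (π₀ mu)) = X mu * aeval θ₂ (e' mu) := by rw [hθ'mu, map_mul, aeval_X, h2]
  have hela : constantCoeff (aeval θ₂ (e' la)) ≠ 0 := by
    rw [CoordChange.constantCoeff_aeval_of_origin _ hθ₂0]; exact he'la
  have hemu : constantCoeff (aeval θ₂ (e' mu)) ≠ 0 := by
    rw [CoordChange.constantCoeff_aeval_of_origin _ hθ₂0]; exact he'mu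
  have hu0c : constantCoeff (aeval θ₂ (θ' (π₀ u))) = 0 := by
    rw [CoordChange.constantCoeff_aeval_of_origin _ hθ₂0]; exact hu0'
  have hf0c : constantCoeff (aeval θ₂ (θ' (π₀ f))) = 0 := by
    rw [CoordChange.constantCoeff_aeval_of_origin _ hθ₂0]; exact hf0'
  have hdetc : coeff (Finsupp.single u 1) (aeval θ₂ (θ' (π₀ u))) * coeff (Finsupp.single f 1) (aeval θ₂ (θ' (π₀ f))) -
      coeff (Finsupp.single f 1) (aeval θ₂ (θ' (π₀ u))) * coeff (Finsupp.single u 1) (aeval θ₂ (θ' (π₀ f))) ≠ 0 := by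
    rw [det_free_block_comp hlu hlf hmu hmf huf hex hθ₂0 h1 h2]
    exact mul_ne_zero hdet' h5
  have hUc : constantCoeff (aeval θ₂ U') ≠ 0 := by
    rw [CoordChange.constantCoeff_aeval_of_origin _ hθ₂0]; exact hU'
  have hEc : deletePthPowers p (aeval θ₂ E') ∈ originIdeal K ^ M :=
    SwapNorm.deletePthPowers_mem_pow p (SwapNorm.aeval_mem_pow hθ₂0 hE')
  exact ⟨B, ⟨fun i => aeval θ₂ (θ' i), fun i => aeval θ₂ (e' i), aeval θ₂ U', deletePthPowers p (aeval θ₂ E'),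
    hsla, hsmu, hela, hemu, hu0c, hf0c, hdetc, hUc, hEc, hrelB⟩, hfr⟩

end ResCone

end Summit.ResolutionOfSingularities.ResolutionOfSingularities.Theorems.PIDim4

end
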